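import Summits.QuantumFields.BalabanUV.Beta.D1BFx.TorusWeightMixedLimit
import Summits.QuantumFields.BalabanUV.Beta.D1BFx.TorusWeightMixedLoc

/-!
# `BalabanUV.Beta.D1BFx.TorusWeightMixedTwisted` — road «BF-x» for binder row D1, slot (K), chain step (I) «(A1)-PACKED», brick «COFRAME-ARRAYS»
# (TB4-W PART 3 at response-packed jets), FILE B «TWISTED-WORD-2»: **THE TWISTED MIXED WEIGHT JET `2•twgtMix` OF `TorusWeightJetsTwisted` IS THE
# PERIODISED ARRAY OF ONE EXPLICIT s-DEPENDENT `ℤ⁴` BOND KERNEL `tBwMix`, s-UNIFORMLY LOCALISED, WITH AN ENTRYWISE INFINITE-VOLUME LIMIT `tBwMixInf`** —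
# the nine term letters of TB4-W 3b-N FILES N3a–N3f (`TorusWeightMixedTerms.W4∕W5∕W7∕W9_eq_hat`, `TorusWeightMixedLoc.biLoc_K•_uniform`,
# `TorusWeightMixedLimit.tendsto_K•`) re-assembled with the TWISTED signs (`tgramMix` carries `−` exactly on the four terms with one transposed odd jet:
# `W₂ W₃ W₅ W₆`), i.e. `tBwMix = 2•(trK K9 + trK K8 + trK K7 + K4 − K5 − trK K5 + K7 + K8 + K9)` versus N3d's `BwMix = 2•(trK K9 − trK K8 − trK K7 + K4 + K5 + trK K5 + K7 + K8 + K9)`;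
# so **`tgramMix (Tjet₀ …) (Tjet₁ b …) (Tjet₁ b′ …) (Tjet₁₁ b b′ …) (Ajet₀ …) (Ajet₁ b …) (Ajet₁ b′ …) (Ajet₁₁ b b′ …) = ((toF (arr s tBwMix))^).submatrix e e`** at
# `b = (σu,κ)`, `b′ = (σu′,l)` — the per-bond-pair summand of PART 3b's `hJN″` letter as an array, for every torus of the road's family

HONEST DEPENDENCY (cell records, verbatim): «continuum YM on T⁴ ⇐ BetaPertH ∧ nine spine estimates (0/9 proved); BetaPertH ⇐ (D1) ∧ (D4) ∧
CAP+tail; G-an2-4 gates asym, D1 and NE2/3/4.»  HONEST FRAMING (cell contract, verbatim): «discharging `BetaPertH` makes Bałaban's UV stability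
UNCONDITIONAL — a real constructive-QFT result; it is NOT the continuum limit and NOT the Clay problem.»  THIS MODULE DISCHARGES NOTHING of (K),
of D1 or of the wall: [our object] two kernel DEFINITIONS (asserting nothing) and [folklore] re-signed bookkeeping over FILES N3c∕N3d∕N3e∕N3f and 3a′
`TorusWeightJetsTwisted` (`twgtMix`, `tgramMix_Tjet`, `transpose_Chat`, `transpose_Cjet₁`) BY NAME.  No `def … : Prop`, nothing cited, 0 sorry.
0∕4 binders of row D1; (K) NOT closed; NOT D1, NOT BetaPertH, NOT continuum, NOT Clay.

ABSOLUTE RULE (cell charter, verbatim): «No internally-minted statement may enter as a cited fact. Every hypothesis is either kernel-proved in this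
package or a verbatim quotation of a PUBLISHED theorem with page reference. The manuscript(s) under audit are NOT citable for their own disputed
steps — they are the thing under adjudication; programme-internal (2001/route/tribunal) claims are never citable.»

CONTENT:
* §1 [our objects] `tBwMix s n a κ u l u′`, `tBwMixInf n a κ u l u′`; `loc_tBwMix`.
* §2 **`two_smul_twgtMix_eq_hat`** (any basis `N` of `ker Ŝ`), **`tgramMix_Tjet_eq_hat_submatrix`**, the `N̂` instances `two_smul_twgtMix_Nhat_eq_hat`,
  `tgramMix_Tjet_Nhat_eq_hat_submatrix`.
* §3 **(u1) `biLoc_tBwMix_uniform`**: ONE s-free constant, rate `dB∕64`, `BiLoc (tBwMix ((m+1)p) (m+1) a κ u l u′) u u′ (C·e^{8|u−u′|₁}) (dB∕64)` for every `p`.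
* §4 **(u2) `tendsto_tBwMix`**: `tBwMix ((m+1)·p k) … → tBwMixInf …` entrywise along `p k → ∞`.
Unit `b2b-balaban-beta-d1-formalise-leaf-03` (gen 23); road owner `b2b-balaban-beta-d1-p2` (`OWNER-MEMO-g17.md` §2 item (2), Q-DICT-N l.40409).
-/

noncomputable section

namespace Summit.QuantumFields.BalabanUV.Beta.D1BFx.TorusWeightMixedTwisted

open Matrix Filter Topology
open scoped BigOperators
open Literature.MathematicalPhysics.QuantumFieldTheory.Balaban1983to89
open Literature.MathematicalPhysics.QuantumFieldTheory.Balaban1983to89.Beta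
open B12Sec2to5 (l1 l1_nonneg)
open ExpKernelCalculus (MKer BiLoc)
open AffineAveraging (box toSite)
open KernelWard (biLoc_add biLoc_sub)
open Summit.QuantumFields.BalabanUV.Beta.TameKernelCalculus (Loc trK biLoc_trK)
open Summit.QuantumFields.BalabanUV.Beta.D1BFx.PeriodicArrays (arr toF)
open Summit.QuantumFields.BalabanUV.Beta.D1BFx.FibredPeriodisation (periodiseF)
open Summit.QuantumFields.BalabanUV.Beta.D1BFx.PeriodisedProjector (Shat)
open Summit.QuantumFields.BalabanUV.Beta.D1BFx.TorusGaugeBasisMatrix (Nhat)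
open Summit.QuantumFields.BalabanUV.Beta.D1BFx.TorusGaugeBasisKernel (Nhat_range Nhat_injective)
open Summit.QuantumFields.BalabanUV.Beta.D1BFx.GramWeightColourLift (tgramMix)
open Summit.QuantumFields.BalabanUV.Beta.D1BFx.TorusCoframeJets (Mjet₀ Mjet₁ Mjet₁₁ Tjet₀ Tjet₁ Tjet₁₁ Ajet₀ Ajet₁ Ajet₁₁)
open Summit.QuantumFields.BalabanUV.Beta.D1BFx.TorusWeightJetsCombFree (Chat Cjet₁ Cjet₁₁)
open Summit.QuantumFields.BalabanUV.Beta.D1BFx.TorusWeightJetsTwisted (twgtMix tgramMix_Tjet transpose_Chat transpose_Cjet₁)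
open Summit.QuantumFields.BalabanUV.Beta.D1BFx.TorusBondArrays (hat_arr_neg hat_arr_smul dB dB_pos)
open Summit.QuantumFields.BalabanUV.Beta.D1BFx.TorusMixedLetters (hat_arr_add_loc hat_arr_sub_loc transpose_hat_arr)
open Summit.QuantumFields.BalabanUV.Beta.D1BFx.TorusWeightMixedTerms (K5 K7 K9 K4 W5_eq_hat W7_eq_hat W9_eq_hat loc_K5 loc_K7 loc_K9)
open Summit.QuantumFields.BalabanUV.Beta.D1BFx.TorusWeightMixedTermW4 (W4_eq_hat loc_K4)
open Summit.QuantumFields.BalabanUV.Beta.D1BFx.TorusWeightMixedLoc (rate_le_one biLoc_pair_of_swap biLoc_K5_uniform biLoc_K7_uniform biLoc_K9_uniform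
  biLoc_K4_uniform)
open Summit.QuantumFields.BalabanUV.Beta.D1BFx.TorusWeightMixedLimit (K5Inf K7Inf K9Inf K4Inf tendsto_K5 tendsto_K7 tendsto_K9 tendsto_K4)

/-! ## §1 The twisted mixed bond kernel and its limit table -/

section Kernel

variable (s : ℕ) [NeZero s] (n : ℕ) [NeZero n] (a : ℝ) (κ : Fin 4) (u : Fin 4 → ℤ) (l : Fin 4) (u' : Fin 4 → ℤ)

/-- [our object] **THE BOND TABLE OF `2•twgtMix`** (N3d's nine terms with the TWISTED signs, `K8 = K7` with the bonds exchanged):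
`2 • (trK K9 + trK K8 + trK K7 + K4 − K5 − trK K5 + K7 + K8 + K9)`.  A definition; asserts nothing. -/
def tBwMix : MKer 4 (Fin 4) :=
  (2 : ℝ) • (trK (K9 s n a κ u l u') + trK (K7 s n a l u' κ u) + trK (K7 s n a κ u l u') + K4 s n a κ u l u' - K5 s n a κ u l u'
    - trK (K5 s n a κ u l u') + K7 s n a κ u l u' + K7 s n a l u' κ u + K9 s n a κ u l u')

/-- [our object] **THE LIMIT TABLE OF `2•twgtMix`** (N3f's limit kernels with the twisted signs).  A definition; asserts nothing. -/
def tBwMixInf : MKer 4 (Fin 4) :=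
  (2 : ℝ) • (trK (K9Inf n a κ u l u') + trK (K7Inf n a l u' κ u) + trK (K7Inf n a κ u l u') + K4Inf n a κ u l u' - K5Inf n a κ u l u'
    - trK (K5Inf n a κ u l u') + K7Inf n a κ u l u' + K7Inf n a l u' κ u + K9Inf n a κ u l u')

end Kernel

/-! ## §2 The identity -/

section Identity

variable (m : ℕ) {a : ℝ} (p : ℕ) [NeZero p] {ρ : Type*} [Fintype ρ] [DecidableEq ρ] (κ : Fin 4) (u : Fin 4 → ℤ) (l : Fin 4) (u' : Fin 4 → ℤ)

/-- [folklore] `Loc (tBwMix s (m+1) a κ u l u′)` for every `s = (m+1)p`. -/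
theorem loc_tBwMix (ha : 0 < a) : Loc (tBwMix ((m + 1) * p) (m + 1) a κ u l u') := by
  have h5 := loc_K5 m p κ u l u' ha
  have h7 := loc_K7 m p κ u l u' ha
  have h8 := loc_K7 m p l u' κ u ha
  have h9 := loc_K9 m p κ u l u' ha
  have h4 := loc_K4 m p κ u l u' ha
  exact ((((((((h9.trK.add h8.trK).add h7.trK).add h4).sub h5).sub h5.trK).add h7).add h8).add h9).smul 2

/-- [folklore] **`2•twgtMix = (arr tBwMix)^`**: twice the TWISTED mixed weight jet of 3a′ at the torus bonds `(σu,κ)`, `(σu′,l)`, over any basis `N` of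
`ker Ŝ`, is the bond-fibred periodisation of TA2's array of the explicit s-dependent `ℤ⁴` kernel `tBwMix` (N3d's nine term letters, four re-signed). -/
theorem two_smul_twgtMix_eq_hat (ha : 0 < a) {N : Matrix (Site 4 ((m + 1) * p)) ρ ℝ}
    (hN : ∀ lam : Site 4 ((m + 1) * p) → ℝ, Shat m ((m + 1) * p) *ᵥ lam = 0 ↔ ∃ c : ρ → ℝ, lam = N *ᵥ c)
    (hNinj : Function.Injective N.mulVec) :
    (2 : ℝ) • twgtMix ((m + 1) * p) (siteOf 4 ((m + 1) * p) u, κ) (siteOf 4 ((m + 1) * p) u', l) N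
      = Matrix.of (periodiseF ((m + 1) * p) (toF (arr ((m + 1) * p) (tBwMix ((m + 1) * p) (m + 1) a κ u l u')))) := by
  have L5 := loc_K5 m p κ u l u' ha
  have L7 := loc_K7 m p κ u l u' ha
  have L8 := loc_K7 m p l u' κ u ha
  have L9 := loc_K9 m p κ u l u' ha
  have L4 := loc_K4 m p κ u l u' ha
  have h5 := W5_eq_hat m p κ u l u' ha hN hNinj
  have h7 := W7_eq_hat m p κ u l u' ha hN hNinj
  have h8 := W7_eq_hat m p l u' κ u ha hN hNinj
  have h9 := W9_eq_hat m p κ u l u' ha hN hNinj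
  have h4 := W4_eq_hat m p κ u l u' ha hN hNinj
  -- the four transposed words (as in N3d)
  have h1 : (Mjet₁₁ ((m + 1) * p) (siteOf 4 ((m + 1) * p) u, κ) (siteOf 4 ((m + 1) * p) u', l))ᵀ * Chat ((m + 1) * p) N * Mjet₀ ((m + 1) * p)
      = Matrix.of (periodiseF ((m + 1) * p) (toF (arr ((m + 1) * p) (trK (K9 ((m + 1) * p) (m + 1) a κ u l u'))))) := by
    rw [show (Mjet₁₁ ((m + 1) * p) (siteOf 4 ((m + 1) * p) u, κ) (siteOf 4 ((m + 1) * p) u', l))ᵀ * Chat ((m + 1) * p) N * Mjet₀ ((m + 1) * p)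
        = ((Mjet₀ ((m + 1) * p))ᵀ * Chat ((m + 1) * p) N * Mjet₁₁ ((m + 1) * p) (siteOf 4 ((m + 1) * p) u, κ) (siteOf 4 ((m + 1) * p) u', l))ᵀ by
      rw [Matrix.transpose_mul, Matrix.transpose_mul, Matrix.transpose_transpose, transpose_Chat, Matrix.mul_assoc], h9, transpose_hat_arr]
  have h2 : (Mjet₁ ((m + 1) * p) (siteOf 4 ((m + 1) * p) u, κ))ᵀ * Cjet₁ ((m + 1) * p) (siteOf 4 ((m + 1) * p) u', l) N * Mjet₀ ((m + 1) * p)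
      = -Matrix.of (periodiseF ((m + 1) * p) (toF (arr ((m + 1) * p) (trK (K7 ((m + 1) * p) (m + 1) a l u' κ u))))) := by
    rw [show (Mjet₁ ((m + 1) * p) (siteOf 4 ((m + 1) * p) u, κ))ᵀ * Cjet₁ ((m + 1) * p) (siteOf 4 ((m + 1) * p) u', l) N * Mjet₀ ((m + 1) * p)
        = -((Mjet₀ ((m + 1) * p))ᵀ * Cjet₁ ((m + 1) * p) (siteOf 4 ((m + 1) * p) u', l) N * Mjet₁ ((m + 1) * p) (siteOf 4 ((m + 1) * p) u, κ))ᵀ by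
      rw [Matrix.transpose_mul, Matrix.transpose_mul, Matrix.transpose_transpose, transpose_Cjet₁]
      simp only [Matrix.neg_mul, Matrix.mul_neg, neg_neg, Matrix.mul_assoc], h8, transpose_hat_arr]
  have h3 : (Mjet₁ ((m + 1) * p) (siteOf 4 ((m + 1) * p) u', l))ᵀ * Cjet₁ ((m + 1) * p) (siteOf 4 ((m + 1) * p) u, κ) N * Mjet₀ ((m + 1) * p)
      = -Matrix.of (periodiseF ((m + 1) * p) (toF (arr ((m + 1) * p) (trK (K7 ((m + 1) * p) (m + 1) a κ u l u'))))) := by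
    rw [show (Mjet₁ ((m + 1) * p) (siteOf 4 ((m + 1) * p) u', l))ᵀ * Cjet₁ ((m + 1) * p) (siteOf 4 ((m + 1) * p) u, κ) N * Mjet₀ ((m + 1) * p)
        = -((Mjet₀ ((m + 1) * p))ᵀ * Cjet₁ ((m + 1) * p) (siteOf 4 ((m + 1) * p) u, κ) N * Mjet₁ ((m + 1) * p) (siteOf 4 ((m + 1) * p) u', l))ᵀ by
      rw [Matrix.transpose_mul, Matrix.transpose_mul, Matrix.transpose_transpose, transpose_Cjet₁]
      simp only [Matrix.neg_mul, Matrix.mul_neg, neg_neg, Matrix.mul_assoc], h7, transpose_hat_arr]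
  have h6 : (Mjet₁ ((m + 1) * p) (siteOf 4 ((m + 1) * p) u', l))ᵀ * Chat ((m + 1) * p) N * Mjet₁ ((m + 1) * p) (siteOf 4 ((m + 1) * p) u, κ)
      = Matrix.of (periodiseF ((m + 1) * p) (toF (arr ((m + 1) * p) (trK (K5 ((m + 1) * p) (m + 1) a κ u l u'))))) := by
    rw [show (Mjet₁ ((m + 1) * p) (siteOf 4 ((m + 1) * p) u', l))ᵀ * Chat ((m + 1) * p) N * Mjet₁ ((m + 1) * p) (siteOf 4 ((m + 1) * p) u, κ)
        = ((Mjet₁ ((m + 1) * p) (siteOf 4 ((m + 1) * p) u, κ))ᵀ * Chat ((m + 1) * p) N * Mjet₁ ((m + 1) * p) (siteOf 4 ((m + 1) * p) u', l))ᵀ by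
      rw [Matrix.transpose_mul, Matrix.transpose_mul, Matrix.transpose_transpose, transpose_Chat, Matrix.mul_assoc], h5, transpose_hat_arr]
  rw [twgtMix, h1, h2, h3, h4, h5, h6, h7, h8, h9, tBwMix, hat_arr_smul,
    hat_arr_add_loc _ (((((((L9.trK.add L8.trK).add L7.trK).add L4).sub L5).sub L5.trK).add L7).add L8) L9,
    hat_arr_add_loc _ ((((((L9.trK.add L8.trK).add L7.trK).add L4).sub L5).sub L5.trK).add L7) L8,
    hat_arr_add_loc _ (((((L9.trK.add L8.trK).add L7.trK).add L4).sub L5).sub L5.trK) L7,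
    hat_arr_sub_loc _ ((((L9.trK.add L8.trK).add L7.trK).add L4).sub L5) L5.trK,
    hat_arr_sub_loc _ (((L9.trK.add L8.trK).add L7.trK).add L4) L5,
    hat_arr_add_loc _ ((L9.trK.add L8.trK).add L7.trK) L4,
    hat_arr_add_loc _ (L9.trK.add L8.trK) L7.trK, hat_arr_add_loc _ L9.trK L8.trK]
  simp only [smul_add, smul_neg, neg_neg, sub_eq_add_neg]

/-- [folklore] **THE TWISTED MIXED CO-FRAME WEIGHT JET OF ONE BOND PAIR IS AN ARRAY**: for any basis `N` of `ker Ŝ` and any re-indexing `e`,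
`tgramMix (Tjet₀ …) (Tjet₁ (σu,κ) …) (Tjet₁ (σu′,l) …) (Tjet₁₁ (σu,κ) (σu′,l) …) (Ajet₀ …) (Ajet₁ (σu,κ) …) (Ajet₁ (σu′,l) …) (Ajet₁₁ …) = ((toF (arr s tBwMix))^).submatrix e e`. -/
theorem tgramMix_Tjet_eq_hat_submatrix (ha : 0 < a) {N : Matrix (Site 4 ((m + 1) * p)) ρ ℝ}
    (hN : ∀ lam : Site 4 ((m + 1) * p) → ℝ, Shat m ((m + 1) * p) *ᵥ lam = 0 ↔ ∃ c : ρ → ℝ, lam = N *ᵥ c)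
    (hNinj : Function.Injective N.mulVec) {ν : Type*} (e : ν → Site 4 ((m + 1) * p) × Fin 4) :
    tgramMix (Tjet₀ ((m + 1) * p) N e) (Tjet₁ ((m + 1) * p) (siteOf 4 ((m + 1) * p) u, κ) N e) (Tjet₁ ((m + 1) * p) (siteOf 4 ((m + 1) * p) u', l) N e)
        (Tjet₁₁ ((m + 1) * p) (siteOf 4 ((m + 1) * p) u, κ) (siteOf 4 ((m + 1) * p) u', l) N e) (Ajet₀ ((m + 1) * p) N)
        (Ajet₁ ((m + 1) * p) (siteOf 4 ((m + 1) * p) u, κ) N) (Ajet₁ ((m + 1) * p) (siteOf 4 ((m + 1) * p) u', l) N)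
        (Ajet₁₁ ((m + 1) * p) (siteOf 4 ((m + 1) * p) u, κ) (siteOf 4 ((m + 1) * p) u', l) N)
      = (Matrix.of (periodiseF ((m + 1) * p) (toF (arr ((m + 1) * p) (tBwMix ((m + 1) * p) (m + 1) a κ u l u'))))).submatrix e e := by
  rw [tgramMix_Tjet, two_smul_twgtMix_eq_hat m p κ u l u' ha hN hNinj]

variable {r : Fin 4 → ℕ}

/-- [folklore] **`2•twgtMix = (arr tBwMix)^` AT THE ROAD's COMB BASIS `N̂`** (`r ∈ box 4 (m+1)`). -/
theorem two_smul_twgtMix_Nhat_eq_hat (ha : 0 < a) (hr : r ∈ box (3 + 1) (m + 1)) :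
    (2 : ℝ) • twgtMix ((m + 1) * p) (siteOf 4 ((m + 1) * p) u, κ) (siteOf 4 ((m + 1) * p) u', l) (Nhat r (m + 1) p)
      = Matrix.of (periodiseF ((m + 1) * p) (toF (arr ((m + 1) * p) (tBwMix ((m + 1) * p) (m + 1) a κ u l u')))) :=
  two_smul_twgtMix_eq_hat m p κ u l u' ha (Nhat_range r m p hr) (Nhat_injective r (m + 1) p hr)

/-- [folklore] **THE TWISTED MIXED CO-FRAME WEIGHT JET OF ONE BOND PAIR AT `N̂` IS AN ARRAY** — the per-pair summand of PART 3b's `hJN″` letter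
(before response packing). -/
theorem tgramMix_Tjet_Nhat_eq_hat_submatrix (ha : 0 < a) (hr : r ∈ box (3 + 1) (m + 1)) {ν : Type*} (e : ν → Site 4 ((m + 1) * p) × Fin 4) :
    tgramMix (Tjet₀ ((m + 1) * p) (Nhat r (m + 1) p) e) (Tjet₁ ((m + 1) * p) (siteOf 4 ((m + 1) * p) u, κ) (Nhat r (m + 1) p) e)
        (Tjet₁ ((m + 1) * p) (siteOf 4 ((m + 1) * p) u', l) (Nhat r (m + 1) p) e)
        (Tjet₁₁ ((m + 1) * p) (siteOf 4 ((m + 1) * p) u, κ) (siteOf 4 ((m + 1) * p) u', l) (Nhat r (m + 1) p) e) (Ajet₀ ((m + 1) * p) (Nhat r (m + 1) p))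
        (Ajet₁ ((m + 1) * p) (siteOf 4 ((m + 1) * p) u, κ) (Nhat r (m + 1) p)) (Ajet₁ ((m + 1) * p) (siteOf 4 ((m + 1) * p) u', l) (Nhat r (m + 1) p))
        (Ajet₁₁ ((m + 1) * p) (siteOf 4 ((m + 1) * p) u, κ) (siteOf 4 ((m + 1) * p) u', l) (Nhat r (m + 1) p))
      = (Matrix.of (periodiseF ((m + 1) * p) (toF (arr ((m + 1) * p) (tBwMix ((m + 1) * p) (m + 1) a κ u l u'))))).submatrix e e :=
  tgramMix_Tjet_eq_hat_submatrix m p κ u l u' ha (Nhat_range r m p hr) (Nhat_injective r (m + 1) p hr) e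

end Identity

/-! ## §3 (u1): s-uniform localisation -/

section Loc

variable (m : ℕ) {a : ℝ}

/-- [folklore] **(u1) FOR `tBwMix`**: ONE s-free constant `C` and ONE rate `dB/64` with
`BiLoc (tBwMix ((m+1)p) (m+1) a κ u l u′) u u′ (C·e^{8|u−u′|₁}) (dB/64)` for every `p` and every bond pair (N3e's term bounds, re-signed sum). -/
theorem biLoc_tBwMix_uniform (ha : 0 < a) : ∃ C : ℝ, 0 ≤ C ∧ ∀ (p : ℕ) [NeZero p] (κ : Fin 4) (u : Fin 4 → ℤ) (l : Fin 4) (u' : Fin 4 → ℤ),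
    BiLoc (tBwMix ((m + 1) * p) (m + 1) a κ u l u') u u' (C * Real.exp (8 * l1 (u - u'))) (dB (m + 1) a / 64) := by
  have hd := dB_pos (m + 1) a ha
  have hr1 := rate_le_one m ha
  obtain ⟨C5, h50, h5⟩ := biLoc_K5_uniform m ha
  obtain ⟨C7, h70, h7⟩ := biLoc_K7_uniform m ha
  obtain ⟨C9, h90, h9⟩ := biLoc_K9_uniform m ha
  obtain ⟨C4, h40, h4⟩ := biLoc_K4_uniform m ha
  refine ⟨|(2 : ℝ)| * (C9 + C7 + C7 + C4 + C5 + C5 + C7 + C7 + C9), by positivity, fun p _ κ u l u' => ?_⟩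
  have hE : ∀ {C : ℝ}, 0 ≤ C → C * Real.exp (4 * l1 (u - u')) ≤ C * Real.exp (8 * l1 (u - u')) :=
    fun hC => mul_le_mul_of_nonneg_left (Real.exp_le_exp.mpr (by linarith [l1_nonneg (u - u')])) hC
  have hswap : ∀ {K : MKer 4 (Fin 4)} {C : ℝ}, 0 ≤ C → BiLoc K u' u (C * Real.exp (4 * l1 (u' - u))) (dB (m + 1) a / 64) →
      BiLoc K u u' (C * Real.exp (8 * l1 (u - u'))) (dB (m + 1) a / 64) := by
    intro K C hC h
    have h2 := biLoc_pair_of_swap (0 : Fin 4) h (by linarith) hr1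
    rw [Beta.l1_sub_comm u' u, mul_assoc, ← Real.exp_add] at h2
    convert h2 using 2; ring_nf
  have D4 := StepJetData.biLoc_weaken (h4 p κ u l u') (hE h40) le_rfl
  have D5 := StepJetData.biLoc_weaken (h5 p κ u l u') (hE h50) le_rfl
  have D7 := StepJetData.biLoc_weaken (h7 p κ u l u') (hE h70) le_rfl
  have D9 := StepJetData.biLoc_weaken (h9 p κ u l u') (hE h90) le_rfl
  have D8 : BiLoc (K7 ((m + 1) * p) (m + 1) a l u' κ u) u u' (C7 * Real.exp (8 * l1 (u - u'))) (dB (m + 1) a / 64) := hswap h70 (h7 p l u' κ u)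
  have T5 : BiLoc (trK (K5 ((m + 1) * p) (m + 1) a κ u l u')) u u' (C5 * Real.exp (8 * l1 (u - u'))) (dB (m + 1) a / 64) := by
    have h := biLoc_trK (h5 p κ u l u'); rw [Beta.l1_sub_comm u u'] at h; exact hswap h50 h
  have T7 : BiLoc (trK (K7 ((m + 1) * p) (m + 1) a κ u l u')) u u' (C7 * Real.exp (8 * l1 (u - u'))) (dB (m + 1) a / 64) := by
    have h := biLoc_trK (h7 p κ u l u'); rw [Beta.l1_sub_comm u u'] at h; exact hswap h70 h
  have T9 : BiLoc (trK (K9 ((m + 1) * p) (m + 1) a κ u l u')) u u' (C9 * Real.exp (8 * l1 (u - u'))) (dB (m + 1) a / 64) := by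
    have h := biLoc_trK (h9 p κ u l u'); rw [Beta.l1_sub_comm u u'] at h; exact hswap h90 h
  have T8 : BiLoc (trK (K7 ((m + 1) * p) (m + 1) a l u' κ u)) u u' (C7 * Real.exp (8 * l1 (u - u'))) (dB (m + 1) a / 64) := by
    have h := biLoc_trK (h7 p l u' κ u); rw [Beta.l1_sub_comm u' u] at h; exact StepJetData.biLoc_weaken h (hE h70) le_rfl
  have h := StepJetData.biLoc_smul
    (biLoc_add (biLoc_add (biLoc_add (biLoc_sub (biLoc_sub (biLoc_add (biLoc_add (biLoc_add T9 T8) T7) D4) D5) T5) D7) D8) D9) (2 : ℝ)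
  rw [tBwMix]
  exact StepJetData.biLoc_weaken h (le_of_eq (by ring)) le_rfl

end Loc

/-! ## §4 (u2): the entrywise limit -/

section Limit

variable (m : ℕ) {a : ℝ} (p : ℕ → ℕ) [∀ k, NeZero (p k)] (κ : Fin 4) (u : Fin 4 → ℤ) (l : Fin 4) (u' : Fin 4 → ℤ)

/-- [folklore] **(u2) FOR `tBwMix`**: along any sequence of coarse periods `p k → ∞`, `tBwMix ((m+1)·p k) (m+1) a κ u l u′ → tBwMixInf (m+1) a κ u l u′`
entrywise (N3f's term limits, re-signed sum). -/
theorem tendsto_tBwMix (ha : 0 < a) (hp : Tendsto p atTop atTop) (x z : Fin 4 → ℤ) (α β : Fin 4) :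
    Tendsto (fun k => tBwMix ((m + 1) * p k) (m + 1) a κ u l u' x z α β) atTop (𝓝 (tBwMixInf (m + 1) a κ u l u' x z α β)) := by
  have T4 := tendsto_K4 m p κ u l u' ha hp
  have T5 := tendsto_K5 m p κ u l u' ha hp
  have T7 := tendsto_K7 m p κ u l u' ha hp
  have T8 := tendsto_K7 m p l u' κ u ha hp
  have T9 := tendsto_K9 m p κ u l u' ha hp
  simp only [tBwMix, tBwMixInf, Pi.smul_apply, Pi.add_apply, Pi.sub_apply, smul_eq_mul, trK]
  exact (((((((((T9 z x β α).add (T8 z x β α)).add (T7 z x β α)).add (T4 x z α β)).sub (T5 x z α β)).sub (T5 z x β α)).add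
    (T7 x z α β)).add (T8 x z α β)).add (T9 x z α β)).const_mul 2

end Limit

end Summit.QuantumFields.BalabanUV.Beta.D1BFx.TorusWeightMixedTwisted

end
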